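import Summits.BirchSwinnertonDyer.BirchSwinnertonDyer.Theorems.EisensteinPrimesCharacterEulerDepletion
import HarnessLib

/-!
# Crux 3 `MazurMCOnCellB` (stmt-BirchSwinnertonDyer-19033), line `twistback` — KERNEL F1, part A (sequel):
# `λ(L_{Σ₀}(X,T)) = λ(L_∅(X,T)) + Σ_{ℓ∈Σ₀} s_ℓ·[θ(ℓ) ≡ ℓ (mod p)]` for GV's character functions `X ∈ {C, D}`,
# and the KL-flat certificate (`L_∅(X, 0)` a `p`-adic unit ⟹ `μ = 0`, `λ(L_{Σ₀}(X,T)) = Σ_ℓ s_ℓ[θ(ℓ) ≡ ℓ]`)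

LEAD bsd-line-x2-p1 g10 (2026-08-28); sequel of `EisensteinPrimesCharacterEulerDepletion.lean` (the Euler elements
`e^C_ℓ`, `e^D_ℓ` and the depletion identities `L_{Σ₀}(X) = L_∅(X)·∏ e^X_ℓ` in `Λ`). HONEST FRAMING (cell `bsd-eis`):
theorems only (no `def`, no named fact, no `sorry`); curve-free; nothing about any elliptic curve / MC / BSD;
0 cells / labels move.

* §5 `hasUnitContent_and_order_eulerElementC/D` — `ord_T(e^X_ℓ mod p) = s_ℓ·[θ(ℓ) = ℓ̄]`, `μ = 0`
  (`s_ℓ = GreenbergVatsal2000.sFactor p ℓ = p^{v_p(f_ℓ)}`, GV Prop. (2.4)); products over `Σ₀`; hence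
  `μ(L_{Σ₀}(X)) = 0 ↔ μ(L_∅(X)) = 0` and `ord_T(L_{Σ₀}(X) mod p) = ord_T(L_∅(X) mod p) + Σ_ℓ s_ℓ[θ(ℓ) = ℓ̄]`
  (`hasUnitContent_iff_and_order_eq_charFunctionC/D`) — display (9) for characters.
* §6 **KL-flat certificate**: if the ONE number `L_∅(X, T = 0)` (`= −B_{1,φω⁻¹}` for `C`, `= −2B_{1,ψ⁻¹·1_{p∤·}}`
  for `D`; Lang Ch. 4 Thm. 3.2 / Greenberg 2001 §4 p. 355: the constant coefficient IS the value at `0`) is a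
  `p`-adic unit, then `L_∅(X) ∈ Λˣ` and for every `Σ₀`: `μ(L_{Σ₀}(X)) = 0`,
  `ord_T(L_{Σ₀}(X) mod p) = Σ_{ℓ∈Σ₀} s_ℓ[θ(ℓ) = ℓ̄]`. For a quadratic `θ = χ_D` this hypothesis is
  `p ∤ (1 − χ_D(p))·B_{1,χ_D}` — `p` inert in `ℚ(√D)` and `p ∤ h(ℚ(√D))` (Iwasawa's class-number criterion, read
  on the analytic side); it is what a «KL-flat partner» of the twistback line supplies.

References: [GreenbergVatsal2000] §1 display (9) p. 9, §2 Prop. (2.4) p. 22, §3 pp. 41–42; [LangCyclotomic1990]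
Ch. 4 §3 Thm. 3.2; [Greenberg2001PastPresent] §4 pp. 355–356; [Washington1997] §7.1.
-/

set_option autoImplicit false

-- `Summit.BirchSwinnertonDyer.BirchSwinnertonDyer.…`: the summit and its single sub-problem share a name.
set_option linter.dupNamespace false

noncomputable section

open scoped Classical

open NumberField IsDedekindDomain PowerSeries Literature.NumberTheory.EllipticCurves
  Literature.NumberTheory.EllipticCurves.CyclotomicZp
  Literature.NumberTheory.EllipticCurves.GreenbergVatsal2000
  Summit.BirchSwinnertonDyer.Rank1Residual.X2.EulerFactorAlgebra
  Summit.BirchSwinnertonDyer.Rank1Residual.X2.EulerFactorInvariants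

namespace Summit.BirchSwinnertonDyer.BirchSwinnertonDyer.Theorems.EisensteinPrimesCharacterEulerDepletion

variable {p : ℕ} [hp : Fact p.Prime]

/-! ## §5. `μ` and `λ` of `L_{Σ₀}(X,T)` from those of `L_∅(X,T)`: `λ(L_{Σ₀}(X)) = λ(L_∅(X)) + Σ_ℓ s_ℓ[θ(ℓ) ≡ ℓ]` -/

section Orders

variable (p) {m d : ℕ} (φ : DirichletCharacter (ZMod p) m) (ψ : DirichletCharacter (ZMod p) d)
  (S₀ : Finset (HeightOneSpectrum (𝓞 ℚ)))

/-- **`ord_T(e^C_ℓ mod p) = s_ℓ·[φ(ℓ) = ℓ̄]`, `μ(e^C_ℓ) = 0`** for a prime `ℓ ≠ p` (`p` odd): the residue of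
`ω(φ(ℓ)ℓ̄⁻¹)` is `φ(ℓ)ℓ̄⁻¹`, which is `1` iff `φ(ℓ) = ℓ̄`; `p^{v_p(f_ℓ)} = s_ℓ`
(`EulerFactorAlgebra.pow_valuation_frobeniusExponent_eq_sFactor`). The `λ`-invariant
`λ((1 − φω⁻¹(ℓ)(1+T)^{f_ℓ}))` of GV p. 42's Euler factor. [cite: GreenbergVatsal2000, §2 Prop. (2.4) (p. 22) and §3 p. 42] -/
theorem hasUnitContent_and_order_eulerElementC (hp2 : p ≠ 2) {ℓ : ℕ} (hℓ : ℓ.Prime) (hℓp : ℓ ≠ p) :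
    HasUnitContent (1 - PowerSeries.C (teichmullerLift p (φ (ℓ : ZMod m) * ((ℓ : ZMod p))⁻¹)) *
        PowerSeries.binomialSeries ℤ_[p] (frobeniusExponent p (ℓ : ℤ_[p]))) ∧
      (PowerSeries.map (PadicInt.toZMod (p := p))
          (1 - PowerSeries.C (teichmullerLift p (φ (ℓ : ZMod m) * ((ℓ : ZMod p))⁻¹)) *
            PowerSeries.binomialSeries ℤ_[p] (frobeniusExponent p (ℓ : ℤ_[p])))).order =
        ((if φ (ℓ : ZMod m) = (ℓ : ZMod p) then sFactor p ℓ else 0 : ℕ) : ℕ∞) := by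
  have pp : p.Prime := Fact.out
  have hpl : ¬ p ∣ ℓ := fun h ↦ hℓp ((Nat.prime_dvd_prime_iff_eq pp hℓ).mp h).symm
  have hcop : p.Coprime ℓ := (Nat.Prime.coprime_iff_not_dvd pp).mpr hpl
  have hℓ0 : (ℓ : ZMod p) ≠ 0 := by rw [Ne, ZMod.natCast_eq_zero_iff]; exact hpl
  obtain ⟨hu, hord⟩ := hasUnitContent_and_order_one_sub_C_mul_binomialSeries
    (teichmullerLift p (φ (ℓ : ZMod m) * ((ℓ : ZMod p))⁻¹)) (frobeniusExponent p (ℓ : ℤ_[p]))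
    (frobeniusExponent_natCast_ne_zero hcop hℓ.one_lt)
  refine ⟨hu, ?_⟩
  rw [hord, toZMod_teichmullerLift]
  have hiff : φ (ℓ : ZMod m) * ((ℓ : ZMod p))⁻¹ = 1 ↔ φ (ℓ : ZMod m) = (ℓ : ZMod p) :=
    mul_inv_eq_one₀ hℓ0
  by_cases hc : φ (ℓ : ZMod m) = (ℓ : ZMod p)
  · rw [if_pos (hiff.mpr hc), if_pos hc, pow_valuation_frobeniusExponent_eq_sFactor hp2 hcop hℓ.one_lt]
  · rw [if_neg (fun h ↦ hc (hiff.mp h)), if_neg hc, Nat.cast_zero]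

/-- **`ord_T(e^D_ℓ mod p) = s_ℓ·[ψ(ℓ) = ℓ̄]`, `μ(e^D_ℓ) = 0`** for a prime `ℓ ≠ p` (`p` odd): the residue of
`ω(ψ(ℓ))·ℓ⁻¹` is `ψ(ℓ)ℓ̄⁻¹` (`EulerFactorInvariants.toZMod_inv_natCast`). The `λ`-invariant of GV p. 42's
Euler factor `1 − ψ(l)l⁻¹(1+T)^{f_l}`. [cite: GreenbergVatsal2000, §2 Prop. (2.4) (p. 22) and §3 p. 42] -/
theorem hasUnitContent_and_order_eulerElementD (hp2 : p ≠ 2) {ℓ : ℕ} (hℓ : ℓ.Prime) (hℓp : ℓ ≠ p) :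
    HasUnitContent (1 - PowerSeries.C (teichmullerLift p (ψ (ℓ : ZMod d)) * (ℓ : ℤ_[p]).inv) *
        PowerSeries.binomialSeries ℤ_[p] (frobeniusExponent p (ℓ : ℤ_[p]))) ∧
      (PowerSeries.map (PadicInt.toZMod (p := p))
          (1 - PowerSeries.C (teichmullerLift p (ψ (ℓ : ZMod d)) * (ℓ : ℤ_[p]).inv) *
            PowerSeries.binomialSeries ℤ_[p] (frobeniusExponent p (ℓ : ℤ_[p])))).order =
        ((if ψ (ℓ : ZMod d) = (ℓ : ZMod p) then sFactor p ℓ else 0 : ℕ) : ℕ∞) := by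
  have pp : p.Prime := Fact.out
  have hpl : ¬ p ∣ ℓ := fun h ↦ hℓp ((Nat.prime_dvd_prime_iff_eq pp hℓ).mp h).symm
  have hcop : p.Coprime ℓ := (Nat.Prime.coprime_iff_not_dvd pp).mpr hpl
  have hℓ0 : (ℓ : ZMod p) ≠ 0 := by rw [Ne, ZMod.natCast_eq_zero_iff]; exact hpl
  obtain ⟨hu, hord⟩ := hasUnitContent_and_order_one_sub_C_mul_binomialSeries
    (teichmullerLift p (ψ (ℓ : ZMod d)) * (ℓ : ℤ_[p]).inv) (frobeniusExponent p (ℓ : ℤ_[p]))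
    (frobeniusExponent_natCast_ne_zero hcop hℓ.one_lt)
  refine ⟨hu, ?_⟩
  rw [hord, map_mul, toZMod_teichmullerLift, toZMod_inv_natCast hcop]
  have hiff : ψ (ℓ : ZMod d) * ((ℓ : ZMod p))⁻¹ = 1 ↔ ψ (ℓ : ZMod d) = (ℓ : ZMod p) :=
    mul_inv_eq_one₀ hℓ0
  by_cases hc : ψ (ℓ : ZMod d) = (ℓ : ZMod p)
  · rw [if_pos (hiff.mpr hc), if_pos hc, pow_valuation_frobeniusExponent_eq_sFactor hp2 hcop hℓ.one_lt]
  · rw [if_neg (fun h ↦ hc (hiff.mp h)), if_neg hc, Nat.cast_zero]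

/-- **`∏_{ℓ∈Σ₀} e^C_ℓ` has `μ = 0` and `ord_T(· mod p) = Σ_{ℓ∈Σ₀} s_ℓ·[φ(ℓ) = ℓ̄]`** (no place of `Σ₀` above
`p`, `p` odd). [cite: GreenbergVatsal2000, §2 Prop. (2.4) (p. 22) and §3 p. 42] -/
theorem hasUnitContent_and_order_prod_eulerElementC (hp2 : p ≠ 2)
    (hS : ∀ v ∈ S₀, ((p : ℕ) : 𝓞 ℚ) ∉ v.asIdeal) :
    HasUnitContent (∏ v ∈ S₀, (1 - PowerSeries.C (teichmullerLift p
        (φ (Rat.HeightOneSpectrum.natGenerator v : ZMod m) *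
          ((Rat.HeightOneSpectrum.natGenerator v : ZMod p))⁻¹)) *
        PowerSeries.binomialSeries ℤ_[p]
          (frobeniusExponent p (Rat.HeightOneSpectrum.natGenerator v : ℤ_[p])))) ∧
      (PowerSeries.map (PadicInt.toZMod (p := p)) (∏ v ∈ S₀, (1 - PowerSeries.C (teichmullerLift p
        (φ (Rat.HeightOneSpectrum.natGenerator v : ZMod m) *
          ((Rat.HeightOneSpectrum.natGenerator v : ZMod p))⁻¹)) *
        PowerSeries.binomialSeries ℤ_[p]
          (frobeniusExponent p (Rat.HeightOneSpectrum.natGenerator v : ℤ_[p]))))).order =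
        ((∑ v ∈ S₀, (if φ (Rat.HeightOneSpectrum.natGenerator v : ZMod m) =
            (Rat.HeightOneSpectrum.natGenerator v : ZMod p)
          then sFactor p (Rat.HeightOneSpectrum.natGenerator v) else 0) : ℕ) : ℕ∞) := by
  induction S₀ using Finset.induction_on with
  | empty =>
    refine ⟨⟨0, ?_⟩, ?_⟩
    · rw [Finset.prod_empty, PowerSeries.coeff_zero_eq_constantCoeff, map_one]; exact isUnit_one
    · rw [Finset.prod_empty, map_one, PowerSeries.order_one, Finset.sum_empty, Nat.cast_zero]
  | insert v S hv ih =>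
    obtain ⟨ihu, iho⟩ := ih (fun w hw ↦ hS w (Finset.mem_insert_of_mem hw))
    obtain ⟨hvu, hvo⟩ := hasUnitContent_and_order_eulerElementC p φ hp2
      (Rat.HeightOneSpectrum.prime_natGenerator v)
      (natGenerator_ne_of_natCast_not_mem v (hS v (Finset.mem_insert_self v S)))
    refine ⟨?_, ?_⟩
    · rw [Finset.prod_insert hv, hasUnitContent_mul_iff]; exact ⟨hvu, ihu⟩
    · rw [Finset.prod_insert hv, map_mul, PowerSeries.order_mul, hvo, iho, Finset.sum_insert hv,
        Nat.cast_add]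

/-- **`∏_{ℓ∈Σ₀} e^D_ℓ` has `μ = 0` and `ord_T(· mod p) = Σ_{ℓ∈Σ₀} s_ℓ·[ψ(ℓ) = ℓ̄]`** (no place of `Σ₀` above
`p`, `p` odd). [cite: GreenbergVatsal2000, §2 Prop. (2.4) (p. 22) and §3 p. 42] -/
theorem hasUnitContent_and_order_prod_eulerElementD (hp2 : p ≠ 2)
    (hS : ∀ v ∈ S₀, ((p : ℕ) : 𝓞 ℚ) ∉ v.asIdeal) :
    HasUnitContent (∏ v ∈ S₀, (1 - PowerSeries.C (teichmullerLift p
        (ψ (Rat.HeightOneSpectrum.natGenerator v : ZMod d)) *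
          (Rat.HeightOneSpectrum.natGenerator v : ℤ_[p]).inv) *
        PowerSeries.binomialSeries ℤ_[p]
          (frobeniusExponent p (Rat.HeightOneSpectrum.natGenerator v : ℤ_[p])))) ∧
      (PowerSeries.map (PadicInt.toZMod (p := p)) (∏ v ∈ S₀, (1 - PowerSeries.C (teichmullerLift p
        (ψ (Rat.HeightOneSpectrum.natGenerator v : ZMod d)) *
          (Rat.HeightOneSpectrum.natGenerator v : ℤ_[p]).inv) *
        PowerSeries.binomialSeries ℤ_[p]
          (frobeniusExponent p (Rat.HeightOneSpectrum.natGenerator v : ℤ_[p]))))).order =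
        ((∑ v ∈ S₀, (if ψ (Rat.HeightOneSpectrum.natGenerator v : ZMod d) =
            (Rat.HeightOneSpectrum.natGenerator v : ZMod p)
          then sFactor p (Rat.HeightOneSpectrum.natGenerator v) else 0) : ℕ) : ℕ∞) := by
  induction S₀ using Finset.induction_on with
  | empty =>
    refine ⟨⟨0, ?_⟩, ?_⟩
    · rw [Finset.prod_empty, PowerSeries.coeff_zero_eq_constantCoeff, map_one]; exact isUnit_one
    · rw [Finset.prod_empty, map_one, PowerSeries.order_one, Finset.sum_empty, Nat.cast_zero]
  | insert v S hv ih =>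
    obtain ⟨ihu, iho⟩ := ih (fun w hw ↦ hS w (Finset.mem_insert_of_mem hw))
    obtain ⟨hvu, hvo⟩ := hasUnitContent_and_order_eulerElementD p ψ hp2
      (Rat.HeightOneSpectrum.prime_natGenerator v)
      (natGenerator_ne_of_natCast_not_mem v (hS v (Finset.mem_insert_self v S)))
    refine ⟨?_, ?_⟩
    · rw [Finset.prod_insert hv, hasUnitContent_mul_iff]; exact ⟨hvu, ihu⟩
    · rw [Finset.prod_insert hv, map_mul, PowerSeries.order_mul, hvo, iho, Finset.sum_insert hv,
        Nat.cast_add]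

/-- **GV's Σ₀-bookkeeping for `L_{Σ₀}(C,T)`, IN THE KERNEL**: for any `L_{Σ₀}(C,T)` and any `L_∅(C,T)`
(`IsCharacterLFunctionC` at `Σ₀` and at `∅`; `p` odd, `m ≥ 1`, no place of `Σ₀` above `p`):
`μ(L_{Σ₀}(C)) = 0 ↔ μ(L_∅(C)) = 0` and `ord_T(L_{Σ₀}(C) mod p) = ord_T(L_∅(C) mod p) + Σ_{ℓ∈Σ₀} s_ℓ·[φ(ℓ) = ℓ̄]`
— the character analogue of display (9) (`λ_{Σ₀} = λ + Σ δ`) for the first factor of (28).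
[cite: GreenbergVatsal2000, §1 display (9) (p. 9), §2 Prop. (2.4), §3 pp. 41–42] -/
theorem hasUnitContent_iff_and_order_eq_charFunctionC [NeZero m] (hp2 : p ≠ 2)
    (hS : ∀ v ∈ S₀, ((p : ℕ) : 𝓞 ℚ) ∉ v.asIdeal) {gS g₀ : IwasawaAlgebra p}
    (hgS : IsCharacterLFunctionC p φ S₀ gS) (hg₀ : IsCharacterLFunctionC p φ ∅ g₀) :
    (HasUnitContent gS ↔ HasUnitContent g₀) ∧
      (PowerSeries.map (PadicInt.toZMod (p := p)) gS).order =
        (PowerSeries.map (PadicInt.toZMod (p := p)) g₀).order +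
          ((∑ v ∈ S₀, (if φ (Rat.HeightOneSpectrum.natGenerator v : ZMod m) =
              (Rat.HeightOneSpectrum.natGenerator v : ZMod p)
            then sFactor p (Rat.HeightOneSpectrum.natGenerator v) else 0) : ℕ) : ℕ∞) := by
  obtain ⟨hPu, hPo⟩ := hasUnitContent_and_order_prod_eulerElementC p φ S₀ hp2 hS
  rw [charFunctionC_eq_mul_prod p φ S₀ hp2 hS hgS hg₀, hasUnitContent_mul_iff, map_mul,
    PowerSeries.order_mul, hPo]
  exact ⟨⟨fun h ↦ h.1, fun h ↦ ⟨h, hPu⟩⟩, rfl⟩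

/-- **GV's Σ₀-bookkeeping for `L_{Σ₀}(D,T)`, IN THE KERNEL**: for any `L_{Σ₀}(D,T)` and any `L_∅(D,T)`
(`p` odd, no place of `Σ₀` above `p`): `μ(L_{Σ₀}(D)) = 0 ↔ μ(L_∅(D)) = 0` and
`ord_T(L_{Σ₀}(D) mod p) = ord_T(L_∅(D) mod p) + Σ_{ℓ∈Σ₀} s_ℓ·[ψ(ℓ) = ℓ̄]` — the character analogue of
display (9) for the second factor of (28). [cite: GreenbergVatsal2000, §1 display (9) (p. 9), §2 Prop. (2.4), §3 p. 42] -/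
theorem hasUnitContent_iff_and_order_eq_charFunctionD (hp2 : p ≠ 2)
    (hS : ∀ v ∈ S₀, ((p : ℕ) : 𝓞 ℚ) ∉ v.asIdeal) {gS g₀ : IwasawaAlgebra p}
    (hgS : IsCharacterLFunctionD p ψ S₀ gS) (hg₀ : IsCharacterLFunctionD p ψ ∅ g₀) :
    (HasUnitContent gS ↔ HasUnitContent g₀) ∧
      (PowerSeries.map (PadicInt.toZMod (p := p)) gS).order =
        (PowerSeries.map (PadicInt.toZMod (p := p)) g₀).order +
          ((∑ v ∈ S₀, (if ψ (Rat.HeightOneSpectrum.natGenerator v : ZMod d) =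
              (Rat.HeightOneSpectrum.natGenerator v : ZMod p)
            then sFactor p (Rat.HeightOneSpectrum.natGenerator v) else 0) : ℕ) : ℕ∞) := by
  obtain ⟨hPu, hPo⟩ := hasUnitContent_and_order_prod_eulerElementD p ψ S₀ hp2 hS
  rw [charFunctionD_eq_mul_prod p ψ S₀ hp2 hS hgS hg₀, hasUnitContent_mul_iff, map_mul,
    PowerSeries.order_mul, hPo]
  exact ⟨⟨fun h ↦ h.1, fun h ↦ ⟨h, hPu⟩⟩, rfl⟩

end Orders

/-! ## §6. The KL-flat certificate: `L_∅(X, 0)` a `p`-adic unit ⟹ `L_∅(X) ∈ Λˣ`, `λ(L_{Σ₀}(X)) = Σ_ℓ s_ℓ[θ(ℓ) = ℓ̄]` -/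

section KLFlat

variable (p) {m d : ℕ} (φ : DirichletCharacter (ZMod p) m) (ψ : DirichletCharacter (ZMod p) d)
  (S₀ : Finset (HeightOneSpectrum (𝓞 ℚ)))

/-- **`μ(g) = 0` and `ord_T(g mod p) = 0` when `g(0)` is a `p`-adic unit** (`g ∈ Λ`, `g(0) = c₀(g)`; Greenberg
2001 §4 p. 355 "`g_i(t) ≡ g_i(0) ≡ b₀ (mod pℤ_p)`"): then `g ∈ Λˣ`, `λ(g) = μ(g) = 0`.
[cite: Greenberg2001PastPresent, §4 p. 355] [cite: Washington1997, §7.1] -/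
theorem hasUnitContent_and_order_eq_zero_of_hasSum_zero_of_norm_eq_one {g : PowerSeries ℤ_[p]}
    {v : ℚ_[p]} (h : HasSum (fun n ↦ ((PowerSeries.coeff n g : ℤ_[p]) : ℚ_[p]) * (0 : ℚ_[p]) ^ n) v)
    (hv : ‖v‖ = 1) :
    HasUnitContent g ∧ (PowerSeries.map (PadicInt.toZMod (p := p)) g).order = 0 := by
  have hc : ‖(PowerSeries.coeff 0 g : ℤ_[p])‖ = 1 := by
    rw [PadicInt.norm_def, coeff_zero_coe_eq_of_hasSum_zero h, hv]
  have hu : IsUnit (PowerSeries.coeff 0 g : ℤ_[p]) := PadicInt.isUnit_iff.mpr hc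
  refine ⟨⟨0, hu⟩, ?_⟩
  have hne : PowerSeries.coeff 0 (PowerSeries.map (PadicInt.toZMod (p := p)) g) ≠ 0 := by
    rw [PowerSeries.coeff_map]
    exact (hu.map _).ne_zero
  exact nonpos_iff_eq_zero.mp (PowerSeries.order_le 0 hne)

/-- **KL-flat certificate for `C`**: if `L_∅(C, 0) = −B_{1, φω⁻¹}` (the value at `k = 1`, `T = 0`; Lang Ch. 4
Thm. 3.2) is a `p`-adic unit, then for ANY `L_{Σ₀}(C,T)` (`Σ₀` without places above `p`): `μ = 0` and
`ord_T(L_{Σ₀}(C) mod p) = Σ_{ℓ∈Σ₀} s_ℓ·[φ(ℓ) = ℓ̄]`. For the curve (`φω⁻¹ = ψ⁻¹` quadratic of discriminant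
`D`) the hypothesis reads `p ∤ (1 − χ_D(p))·B_{1,χ_D}`, i.e. `p` inert in `ℚ(√D)` and `p ∤ h(ℚ(√D))` —
Iwasawa's class-number criterion on the analytic side. [cite: Greenberg2001PastPresent, §4 pp. 355–356]
[cite: GreenbergVatsal2000, §3 pp. 41–42 ((26), Σ₀-depletion)] [cite: LangCyclotomic1990, Ch. 4 §3 Thm. 3.2] -/
theorem hasUnitContent_and_order_eq_charFunctionC_of_norm_eq_one [NeZero m] (hp2 : p ≠ 2)
    (hS : ∀ v ∈ S₀, ((p : ℕ) : 𝓞 ℚ) ∉ v.asIdeal) {gS g₀ : IwasawaAlgebra p}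
    (hgS : IsCharacterLFunctionC p φ S₀ gS) (hg₀ : IsCharacterLFunctionC p φ ∅ g₀)
    (h1 : ‖characterLValueC p φ ∅ 1‖ = 1) :
    HasUnitContent gS ∧
      (PowerSeries.map (PadicInt.toZMod (p := p)) gS).order =
        ((∑ v ∈ S₀, (if φ (Rat.HeightOneSpectrum.natGenerator v : ZMod m) =
            (Rat.HeightOneSpectrum.natGenerator v : ZMod p)
          then sFactor p (Rat.HeightOneSpectrum.natGenerator v) else 0) : ℕ) : ℕ∞) := by
  have h := hg₀ 1 le_rfl
  simp only [Nat.sub_self, pow_zero, sub_self] at h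
  obtain ⟨hu₀, ho₀⟩ := hasUnitContent_and_order_eq_zero_of_hasSum_zero_of_norm_eq_one p h h1
  obtain ⟨hiff, hord⟩ := hasUnitContent_iff_and_order_eq_charFunctionC p φ S₀ hp2 hS hgS hg₀
  exact ⟨hiff.mpr hu₀, by rw [hord, ho₀, zero_add]⟩

/-- **KL-flat certificate for `D`**: if `L_∅(D, 0) = −2B_{1, ψ⁻¹·1_{p∤·}}` (the value at `k = 1`, `T = 0`) is a
`p`-adic unit, then for ANY `L_{Σ₀}(D,T)` (`Σ₀` without places above `p`): `μ = 0` and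
`ord_T(L_{Σ₀}(D) mod p) = Σ_{ℓ∈Σ₀} s_ℓ·[ψ(ℓ) = ℓ̄]`. [cite: Greenberg2001PastPresent, §4 pp. 355–356]
[cite: GreenbergVatsal2000, §3 p. 42 ((27), Σ₀-depletion)] [cite: LangCyclotomic1990, Ch. 4 §3 Thm. 3.2] -/
theorem hasUnitContent_and_order_eq_charFunctionD_of_norm_eq_one (hp2 : p ≠ 2)
    (hS : ∀ v ∈ S₀, ((p : ℕ) : 𝓞 ℚ) ∉ v.asIdeal) {gS g₀ : IwasawaAlgebra p}
    (hgS : IsCharacterLFunctionD p ψ S₀ gS) (hg₀ : IsCharacterLFunctionD p ψ ∅ g₀)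
    (h1 : ‖characterLValueD p ψ ∅ 1‖ = 1) :
    HasUnitContent gS ∧
      (PowerSeries.map (PadicInt.toZMod (p := p)) gS).order =
        ((∑ v ∈ S₀, (if ψ (Rat.HeightOneSpectrum.natGenerator v : ZMod d) =
            (Rat.HeightOneSpectrum.natGenerator v : ZMod p)
          then sFactor p (Rat.HeightOneSpectrum.natGenerator v) else 0) : ℕ) : ℕ∞) := by
  have h := hg₀ 1 le_rfl
  simp only [Nat.sub_self, pow_zero, sub_self] at h
  obtain ⟨hu₀, ho₀⟩ := hasUnitContent_and_order_eq_zero_of_hasSum_zero_of_norm_eq_one p h h1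
  obtain ⟨hiff, hord⟩ := hasUnitContent_iff_and_order_eq_charFunctionD p ψ S₀ hp2 hS hgS hg₀
  exact ⟨hiff.mpr hu₀, by rw [hord, ho₀, zero_add]⟩

end KLFlat

end Summit.BirchSwinnertonDyer.BirchSwinnertonDyer.Theorems.EisensteinPrimesCharacterEulerDepletion

end
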